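import Mathlib
import Summits.ValiantsHypothesis.ValiantsHypothesis.Theses.ElementaryWordLength
import Literature.Computability.AlgebraicComplexity.PermanentIrreducible

/-!
# Census sketch for crux `WordLengthQP` (stmt-ValiantsHypothesis-6623) — crux-strategist, RESTATED re-exam

Typed candidates behind `STRATEGY-CENSUS.md` (this seat).  Nothing here is filed as an item.

* `WordLengthQPpm1`  — D4-const piece A: constant-free (letters `λ ∈ {1,-1}`) quasi-polynomial word
  length of `E₀₂(per_n)` is unbounded ("constant-free EVH in word form").  WEAKER than the crux
  (`wordLengthQPpm1_of_wordLengthQP`).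
* `ConstElimWordsQP` — D4-const piece B: quasi-polynomial CONSTANT ELIMINATION for words computing a
  0/1-coefficient target (general, per-free, matched quasi-polynomial template).
* `wordLengthQP_of_constElim_pm1` — the assembly `B → A → X`, PROVED: it is ten lines of logic
  (the seam is modus tollens), which is WHY this split is recorded as failing criterion (b) of the
  BC2 redirect exemption although it passes (a) and (c).
* `StepAmplification` — the STRENGTHEN entry S⁺_step (constant-factor gain per added row).
-/

set_option linter.dupNamespace false

noncomputable section

namespace Summit.ValiantsHypothesis.ValiantsHypothesis.Cruxes.WordLengthQP.Census

open Literature.Computability.AlgebraicComplexity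
open Summit.ValiantsHypothesis.ValiantsHypothesis.Theses.ElementaryWordLength (WordLengthQP)

/-- D4-const, piece A (`A_{±1}`): there is no `c` such that for every `n` the transvection
`E₀₂(per_n)` is a product of at most `2^((log₂ n + c)^c)` elementary letters `E_ij(±1)`,
`E_ij(±x_kl)` — the INTEGRAL (constant-free) elementary word length of the permanent transvection in
`E₃(ℤ[x_11,…,x_nn])` is not quasi-polynomially bounded.  Weaker than `WordLengthQP` (such words are
complex words); equivalent to "per has no quasi-polynomial constant-free formulas" by Ben-Or–Cleve
both ways (both conversions are constant-free). -/
def WordLengthQPpm1 : Prop :=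
  ¬ ∃ c : ℕ, ∀ n : ℕ, ∃ w : List (Fin 3 × Fin 3 × ℂ × Option (Fin n × Fin n)),
    (∀ l ∈ w, l.2.2.1 = 1 ∨ l.2.2.1 = -1) ∧
    w.length ≤ 2 ^ ((Nat.log 2 n + c) ^ c) ∧ (∀ l ∈ w, l.1 ≠ l.2.1) ∧
    (w.map (fun l => Matrix.transvection l.1 l.2.1
      (MvPolynomial.C l.2.2.1 * l.2.2.2.elim 1 MvPolynomial.X))).prod =
      Matrix.transvection (0 : Fin 3) 2 (perPoly (Fin n) ℂ)

/-- D4-const, piece B (`ConstElimWordsQP`, general / per-free): quasi-polynomial constant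
elimination in `E₃` — for every `c` there is `c'` such that for all `n` and every target
`F ∈ ℂ[x_11..x_nn]` with coefficients in `{0,1}`, if `E₀₂(F)` has a complex elementary word of
length `≤ 2^((log₂ n + c)^c)` then it has a `{±1}`-word of length `≤ 2^((log₂ n + c')^c')`. -/
def ConstElimWordsQP : Prop :=
  ∀ c : ℕ, ∃ c' : ℕ, ∀ n : ℕ, ∀ F : MvPolynomial (Fin n × Fin n) ℂ,
    (∀ m, F.coeff m = 0 ∨ F.coeff m = 1) →
    (∃ w : List (Fin 3 × Fin 3 × ℂ × Option (Fin n × Fin n)),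
      w.length ≤ 2 ^ ((Nat.log 2 n + c) ^ c) ∧ (∀ l ∈ w, l.1 ≠ l.2.1) ∧
      (w.map (fun l => Matrix.transvection l.1 l.2.1
        (MvPolynomial.C l.2.2.1 * l.2.2.2.elim 1 MvPolynomial.X))).prod =
        Matrix.transvection (0 : Fin 3) 2 F) →
    ∃ w : List (Fin 3 × Fin 3 × ℂ × Option (Fin n × Fin n)),
      (∀ l ∈ w, l.2.2.1 = 1 ∨ l.2.2.1 = -1) ∧
      w.length ≤ 2 ^ ((Nat.log 2 n + c') ^ c') ∧ (∀ l ∈ w, l.1 ≠ l.2.1) ∧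
      (w.map (fun l => Matrix.transvection l.1 l.2.1
        (MvPolynomial.C l.2.2.1 * l.2.2.2.elim 1 MvPolynomial.X))).prod =
        Matrix.transvection (0 : Fin 3) 2 F

/-- The permanent has coefficients in `{0, 1}`. [folklore] -/
theorem coeff_perPoly_zero_or_one (n : ℕ) (m : (Fin n × Fin n) →₀ ℕ) :
    (perPoly (Fin n) ℂ).coeff m = 0 ∨ (perPoly (Fin n) ℂ).coeff m = 1 := by
  classical
  by_cases h : ∃ ρ : Equiv.Perm (Fin n), permMonomial ρ = m
  · obtain ⟨ρ, rfl⟩ := h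
    exact Or.inr (coeff_permMonomial_perPoly ℂ ρ)
  · left
    rw [coeff_perPoly ℂ]
    refine Finset.sum_eq_zero fun ρ _ => ?_
    rw [if_neg]
    exact fun hρ => h ⟨ρ, hρ⟩

/-- **The D4-const assembly, PROVED — and it is a trivial seam.**  `B → A → X` is modus tollens:
quasi-polynomial complex words for `per_n` (¬X) would, by constant elimination (B), give
quasi-polynomial `±1`-words, contradicting A.  No mathematics happens between the two open pieces;
this is why the split is NOT filed (criterion (b) of the BC2 redirect exemption). -/
theorem wordLengthQP_of_constElim_pm1 (hB : ConstElimWordsQP) (hA : WordLengthQPpm1) :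
    WordLengthQP := by
  unfold Summit.ValiantsHypothesis.ValiantsHypothesis.Theses.ElementaryWordLength.WordLengthQP
  rintro ⟨c, hc⟩
  obtain ⟨c', hc'⟩ := hB c
  exact hA ⟨c', fun n => hc' n _ (coeff_perPoly_zero_or_one n) (hc n)⟩

/-- A is a CONSEQUENCE of X (so it is weaker-or-equal; the converse is open = constant
elimination). -/
theorem wordLengthQPpm1_of_wordLengthQP (hX : WordLengthQP) : WordLengthQPpm1 := by
  rintro ⟨c, hc⟩
  apply hX
  exact ⟨c, fun n => by
    obtain ⟨w, -, hlen, hvalid, hprod⟩ := hc n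
    exact ⟨w, hlen, hvalid, hprod⟩⟩

/-- STRENGTHEN entry `S⁺_step`: a constant-factor gain in word length per added row —
`wl(per_n) ≥ (1+δ)·wl(per_{n-1})` eventually.  It implies `wl(per_n) ≥ (1+δ)^{n-n₀}`, hence X
(exponential ≫ quasi-polynomial); the census explains why the only handle (restriction by one row and
one column kills a `2/n` fraction of a balanced word) compounds to a polynomial, not to `(1+δ)^n`. -/
def StepAmplification : Prop :=
  ∃ δ : ℝ, 0 < δ ∧ ∃ n₀ : ℕ, ∀ n ≥ n₀, ∀ L : ℕ,
    (∃ w : List (Fin 3 × Fin 3 × ℂ × Option (Fin (n + 1) × Fin (n + 1))),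
      w.length ≤ L ∧ (∀ l ∈ w, l.1 ≠ l.2.1) ∧
      (w.map (fun l => Matrix.transvection l.1 l.2.1
        (MvPolynomial.C l.2.2.1 * l.2.2.2.elim 1 MvPolynomial.X))).prod =
        Matrix.transvection (0 : Fin 3) 2 (perPoly (Fin (n + 1)) ℂ)) →
    ∃ w' : List (Fin 3 × Fin 3 × ℂ × Option (Fin n × Fin n)),
      (∀ l ∈ w', l.1 ≠ l.2.1) ∧
      (w'.map (fun l => Matrix.transvection l.1 l.2.1
        (MvPolynomial.C l.2.2.1 * l.2.2.2.elim 1 MvPolynomial.X))).prod =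
        Matrix.transvection (0 : Fin 3) 2 (perPoly (Fin n) ℂ) ∧
      (1 + δ) * (w'.length : ℝ) ≤ L

end Summit.ValiantsHypothesis.ValiantsHypothesis.Cruxes.WordLengthQP.Census

end
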